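import Literature.NumberTheory.EllipticCurves.WeierstrassSchemeAffineChart
import HarnessLib

/-!
# The affine chart `Spec K[W] ↪ E_W` is an open immersion

Sequel to `EllipticCurves/WeierstrassSchemeAffineChart`. For an elliptic curve `W` over a field `K`
the affine chart `affineChart W : Spec K[W] → E_W = V₊(F) ⊂ ℙ²_K` (Silverman, *AEC* III.1: the
open piece `Z ≠ 0` of the plane cubic, `E ∩ {Z ≠ 0} = {(x, y) | W(x, y) = 0}`) is an **open
immersion** onto `E_W ∩ D₊(Z)` (`isOpenImmersion_affineChart_left`, `opensRange_chartHom`):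
corestricted to the open subscheme `U = E_W ∩ D₊(Z)` it is a closed immersion (its composite with
the closed immersion `U ↪ D₊(Z)` is the closed immersion `Spec K[W] ↪ Spec (K[X,Y,Z]_{(Z)})₀ ≅ D₊(Z)`),
surjective (the image of the chart is all of `U`), into a reduced scheme (`E_W` is integral for
`W` elliptic), hence an isomorphism (Mathlib `isIso_of_isClosedImmersion_of_surjective`, the
universal property of the reduced induced structure, Hartshorne II Ex. 3.11(d)).

This is the `chart`/`isOpenImmersion_chart`/`chart_over` part of
`WeierstrassCurve.IsAbelianVarietyModel` (`EllipticCurves/AbelianVarietyModel`) for the model `E_W`,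
the identification of its chart points being `chartPoint_affineChart` of the prequel.

## References

* [SilvermanAEC2009] J. H. Silverman, *The Arithmetic of Elliptic Curves*, 2nd ed., III.1.
* [Hartshorne1977] R. Hartshorne, *Algebraic Geometry*, II Prop. 2.5, II Ex. 3.11(d).

## Design

The underlying morphisms of schemes are given syntactically clean types (`chartHom`, `ιHom`)
so that Mathlib's restriction / cancellation lemmas apply by `rw`.
-/

noncomputable section

open CategoryTheory AlgebraicGeometry HomogeneousLocalization MvPolynomial
open Literature.AlgebraicGeometry.Motives

universe u

namespace WeierstrassCurve

variable {K : Type u} [Field K] (W : WeierstrassCurve K)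

attribute [local instance] MvPolynomial.gradedAlgebra ProjBaseChange.algebraBase
  ProjBaseChange.isScalarTower_localization

local notation "𝒜" => MvPolynomial.homogeneousSubmodule (Fin 3) K

/-- The affine chart as a morphism of schemes `Spec K[W] → E_W`. [cite: SilvermanAEC2009, III.1] -/
abbrev chartHom : Spec (CommRingCat.of W.toAffine.CoordinateRing) ⟶ W.scheme.left :=
  W.affineChart.left

/-- The closed immersion `E_W ↪ ℙ²_K` as a morphism of schemes. [folklore] -/
abbrev ιHom : W.scheme.left ⟶ Proj 𝒜 :=
  W.schemeι.left

/-- `E_W ↪ ℙ²_K` is a closed immersion (scheme-level form). [folklore] -/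
instance isClosedImmersion_ιHom : IsClosedImmersion W.ιHom :=
  W.isClosedImmersion_schemeι_left

/-- The open `U = E_W ∩ D₊(Z) = ι⁻¹ D₊(Z)` of the plane cubic. [cite: SilvermanAEC2009, III.1] -/
abbrev chartOpens : W.scheme.left.Opens :=
  W.ιHom ⁻¹ᵁ Proj.basicOpen 𝒜 (X 2)

/-- The image of the affine chart is `U`. [cite: SilvermanAEC2009, III.1] -/
theorem range_chartHom : Set.range W.chartHom = (W.chartOpens : Set W.scheme.left) :=
  W.range_affineChart_left

/-- `chartHom ≫ ιHom = Spec (awayToAffine) ≫ awayι`. [folklore] -/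
theorem chartHom_comp_ιHom : W.chartHom ≫ W.ιHom =
    Spec.map (CommRingCat.ofHom W.awayToAffine.toRingHom) ≫
      Proj.awayι 𝒜 (X 2) (ProjectiveSpace.X_mem (2 : Fin 3)) one_pos :=
  W.affineChart_left_comp

/-- The affine chart corestricted to the open subscheme `U = E_W ∩ D₊(Z)`. [folklore] -/
def affineChartRes : Spec (CommRingCat.of W.toAffine.CoordinateRing) ⟶ (W.chartOpens : Scheme.{u}) :=
  IsOpenImmersion.lift W.chartOpens.ι W.chartHom (by rw [Scheme.Opens.range_ι, range_chartHom])

/-- `affineChartRes ≫ U.ι = chartHom`. [folklore] -/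
@[reassoc (attr := simp)]
theorem affineChartRes_ι : W.affineChartRes ≫ W.chartOpens.ι = W.chartHom :=
  IsOpenImmersion.lift_fac _ _ _

/-- The corestricted chart is surjective onto `U`. [folklore] -/
instance surjective_affineChartRes : Surjective W.affineChartRes := by
  refine ⟨fun u ↦ ?_⟩
  have hu : (W.chartOpens.ι u : W.scheme.left) ∈ Set.range W.chartHom := by
    rw [range_chartHom]
    exact u.2
  obtain ⟨p, hp⟩ := hu
  refine ⟨p, W.chartOpens.ι.isOpenEmbedding.injective ?_⟩
  rw [← Scheme.Hom.comp_apply, affineChartRes_ι, hp]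

/-- `U ↪ D₊(Z)`, the restriction of the closed immersion `E_W ↪ ℙ²_K` over `D₊(Z)`, is a closed
immersion. [folklore] -/
instance isClosedImmersion_ιHom_restrict : IsClosedImmersion (W.ιHom ∣_ Proj.basicOpen 𝒜 (X 2)) :=
  IsZariskiLocalAtTarget.restrict (P := @IsClosedImmersion) inferInstance _

/-- `Spec K[W] → Spec (K[X,Y,Z]_{(Z)})₀` is a closed immersion (scheme-level form). [folklore] -/
instance isClosedImmersion_specMap_awayToAffine :
    IsClosedImmersion (Spec.map (CommRingCat.ofHom W.awayToAffine.toRingHom)) :=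
  W.isClosedImmersion_toAwayChart_left

/-- The corestricted chart followed by `U ↪ D₊(Z)` is `Spec K[W] → Spec (K[X,Y,Z]_{(Z)})₀ ≅ D₊(Z)`.
[folklore] -/
theorem affineChartRes_comp_restrict :
    W.affineChartRes ≫ (W.ιHom ∣_ Proj.basicOpen 𝒜 (X 2)) =
      Spec.map (CommRingCat.ofHom W.awayToAffine.toRingHom) ≫
        (Proj.basicOpenIsoSpec 𝒜 (X 2) (ProjectiveSpace.X_mem (2 : Fin 3)) one_pos).inv := by
  rw [← cancel_mono (Proj.basicOpen 𝒜 (X 2)).ι, Category.assoc, morphismRestrict_ι, Category.assoc,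
    Proj.basicOpenIsoSpec_inv_ι]
  change W.affineChartRes ≫ W.chartOpens.ι ≫ W.ιHom = _
  rw [affineChartRes_ι_assoc, chartHom_comp_ιHom]

/-- The corestricted chart `Spec K[W] → U` is a closed immersion. [folklore] -/
instance isClosedImmersion_affineChartRes : IsClosedImmersion W.affineChartRes := by
  have : IsClosedImmersion (W.affineChartRes ≫ (W.ιHom ∣_ Proj.basicOpen 𝒜 (X 2))) := by
    rw [affineChartRes_comp_restrict]
    infer_instance
  exact IsClosedImmersion.of_comp_isClosedImmersion W.affineChartRes (W.ιHom ∣_ Proj.basicOpen 𝒜 (X 2))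

section Elliptic

variable [W.IsElliptic]

/-- `U` is reduced (an open subscheme of the integral `E_W`). [folklore] -/
instance isReduced_chartOpens : IsReduced (W.chartOpens : Scheme.{u}) :=
  isReduced_of_isOpenImmersion W.chartOpens.ι

/-- **The corestricted chart `Spec K[W] → U = E_W ∩ D₊(Z)` is an isomorphism**: a surjective closed
immersion into a reduced scheme (Hartshorne II Ex. 3.11(d); Mathlib
`isIso_of_isClosedImmersion_of_surjective`). [cite: Hartshorne1977, II Ex. 3.11(d)] -/
instance isIso_affineChartRes : IsIso W.affineChartRes :=
  isIso_of_isClosedImmersion_of_surjective _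

/-- **The affine chart `Spec K[W] ↪ E_W` is an open immersion** (scheme-level form; Silverman,
*AEC* III.1: the affine Weierstrass curve is the open piece `Z ≠ 0` of the plane cubic).
[cite: SilvermanAEC2009, III.1] -/
instance isOpenImmersion_chartHom : IsOpenImmersion W.chartHom := by
  rw [← affineChartRes_ι]
  infer_instance

/-- **The affine chart `Spec K[W] ↪ E_W` is an open immersion** (the form consumed by
`WeierstrassCurve.IsAbelianVarietyModel.isOpenImmersion_chart`). [cite: SilvermanAEC2009, III.1] -/
theorem isOpenImmersion_affineChart_left : IsOpenImmersion W.affineChart.left :=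
  W.isOpenImmersion_chartHom

/-- The image of the affine chart is the open `E_W ∩ D₊(Z)`. [cite: SilvermanAEC2009, III.1] -/
theorem opensRange_chartHom : W.chartHom.opensRange = W.chartOpens :=
  TopologicalSpace.Opens.ext W.range_chartHom

end Elliptic

end WeierstrassCurve
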